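import Mathlib
import Summits.NavierStokesRegularity.NavierStokesRegularity.Theorems.SubOnsagerCeilingKPLeakPocketFlux
import Summits.NavierStokesRegularity.NavierStokesRegularity.Theorems.SubOnsagerCeilingKPBarrierCurrency
import Summits.NavierStokesRegularity.NavierStokesRegularity.Theorems.SubcriticalEnvelopeForwardSourceTailEnvelopeKPDyadicRatioTwo
import HarnessLib

/-!
# STARVED NETWORKS WITH A SHARED LEAK POCKET — the ν-uniform shell barrier (part 3 of 3)
# (helper file for the crux `SubOnsagerCeiling.ForwardTailCeilingKP`, stmt-NavierStokesRegularity-27057, `--supports`)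

Sequel of `Theorems/SubOnsagerCeilingKPLeakPocket{Starvation,Flux}.lean` (the LEAK-POCKET class: live modes `0,1,2` with ANY diagonal
forward network among them — chains, pairs, 3-cycles, fans, merging —, leaking diagonally into the shared dead-end pocket `3`, no in-shell
coupling; strengths `ρ·w_{ae} ≤ W_a`, `κ·(w_{a0}+w_{a1}+w_{a2}) ≤ W_a`).

* `leakPocket_shellBarrierAt` — `ShellBarrierAt R ε₀ α` with `(1+ε₀)^{2θ} = 1 + ρκ`, `D = (1+ρκ)²`, at EVERY scale ratio when `ρκ > ε₀`
  (the leak analogue of `sharedPocket_shellBarrierAt`; generalises the one-chain leak spray `leakSpray_shellBarrierAt` to arbitrary live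
  networks);
* `leakPocket_ceilingAt`, `leakPocket_primaryGraded` — the same in the currencies `CeilingAt` and the skeleton's `PrimaryGradedAt` body.

HONEST FRAMING: statements about Tao-type MODEL lattice ODEs (route SubOnsagerCeiling, rung TL-M2Break); one architecture class; no stub,
crux or summit is proved and nothing here bears on Navier–Stokes regularity. [cite: Tao2016AveragedNS, §4 (4.2)–(4.3), (4.13)]
-/

noncomputable section

-- the sub-problem namespace `NavierStokesRegularity.NavierStokesRegularity` is the tree's layout (D-0017)
set_option linter.dupNamespace false

namespace Summit.NavierStokesRegularity.NavierStokesRegularity.Theorems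

open Set Finset MeasureTheory intervalIntegral
open scoped Topology
open Literature.Analysis.FluidPDE.TaoCascade
open Summit.NavierStokesRegularity.NavierStokesRegularity.Theorems.SubOnsagerCeiling

/-- **ENERGY STARVATION BARRIER, CLASS-WIDE LEAK FORM (shared leak pocket).**  For every KP network proper `α ∈ E₂(R)` of the
leak-pocket class and all `ρ, κ ≥ 0` with `ρ·w_{ae} ≤ W_a` (`e` live), `κ·(w_{a0}+w_{a1}+w_{a2}) ≤ W_a` and `ρκ > ε₀`:
`ShellBarrierAt R ε₀ α` with `(1+ε₀)^{2θ} = 1 + ρκ`, `D = (1+ρκ)²`, at EVERY scale ratio `1 + ε₀ > 1`. MODEL lattice statement; a corner of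
the registered stubs, not the stubs. [cite: Tao2016AveragedNS, §4 (4.13)] -/
theorem leakPocket_shellBarrierAt {α : Fin 4 → Fin 4 → Fin 4 → ℤ × ℤ × ℤ → ℝ} {ε₀ ρ κ : ℝ}
    (hε : 0 < ε₀) (hρ0 : 0 ≤ ρ) (hκ0 : 0 ≤ κ) (hgap : ε₀ < ρ * κ)
    (hρ : ∀ a e : Fin 4, e ≠ 3 → ρ * α a a e (0, 0, 1) ≤ α a a 3 (0, 0, 1))
    (hκ : ∀ a : Fin 4, κ * (α a a 0 (0, 0, 1) + α a a 1 (0, 0, 1) + α a a 2 (0, 0, 1)) ≤ α a a 3 (0, 0, 1))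
    (hD : ∀ a b i : Fin 4, a ≠ b → α a b i (0, 0, 1) = 0)
    (h3w : ∀ e : Fin 4, α 3 3 e (0, 0, 1) = 0) (hIn : ∀ a b i : Fin 4, α a b i (0, 0, 0) = 0) (R : ℝ) :
    ShellBarrierAt R ε₀ α := by
  intro hT hO
  have hs : IsSymmetricCoeff α := hT.1
  have hc : IsCancellingCoeff α := hT.2.1
  set r : ℝ := ρ * κ with hr
  have hr0' : 0 ≤ r := by positivity
  have hr0 : 0 < 1 + r := by positivity
  have hb1 : (1 : ℝ) < 1 + ε₀ := by linarith
  have hb0 : (0 : ℝ) < 1 + ε₀ := by linarith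
  have hrb : 1 + ε₀ < 1 + r := by simp only [hr]; linarith
  set θ : ℝ := Real.logb (1 + ε₀) (1 + r) / 2 with hθ
  have hθhalf : 1 / 2 < θ := by
    have : 1 < Real.logb (1 + ε₀) (1 + r) := by
      rw [Real.lt_logb_iff_rpow_lt hb1 hr0, Real.rpow_one]
      exact hrb
    simp only [hθ]
    linarith
  have hpow : (1 + ε₀) ^ (2 * θ) = 1 + r := by
    have : 2 * θ = Real.logb (1 + ε₀) (1 + r) := by simp only [hθ]; ring
    rw [this, Real.rpow_logb hb0 hb1.ne' hr0]
  refine ⟨θ, hθhalf, (1 + r) ^ 2, by positivity, ?_⟩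
  intro ν hν X₀ s _hs X hX0 hXneg _hM hXc hXd hXpos t ht i k
  set E₀ : ℝ := ∑ j : Fin 4, (1 / 2 : ℝ) * X₀ j ^ 2 with hE₀
  have hE₀0 : 0 ≤ E₀ := Finset.sum_nonneg fun j _ => by positivity
  have hq1 : (1 + r) * (1 + r)⁻¹ = 1 := mul_inv_cancel₀ hr0.ne'
  have h1r : (1 : ℝ) ≤ 1 + r := by linarith
  -- gate fluxes: `∫ OUT_m ≤ E₀ (1+r) q^m`
  have hgate : ∀ m : ℕ, ∫ τ in (0 : ℝ)..t, (1 + ε₀) ^ ((5 : ℝ) * (m : ℝ) / 2) *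
      ∑ i', ∑ j, α i' i' j (0, 0, 1) * X i' (m : ℤ) τ ^ 2 * X j ((m : ℤ) + 1) τ ≤ E₀ * (1 + r) * ((1 + r)⁻¹) ^ m := by
    intro m
    cases m with
    | zero =>
      have h := kpProper_bondFlux_budget hs hc hO hD hb0 hν.le hX0 hXneg hXc hXd 0 t ht
      have h1 : E₀ ≤ E₀ * (1 + r) * ((1 + r)⁻¹) ^ 0 := by
        rw [pow_zero, mul_one]
        nlinarith
      exact h.trans h1
    | succ m =>
      have hout := leakPocket_out_le_liveIn hs hc hO hD h3w hIn hε.le hν.le hX0 hXc hXd (n := (m : ℤ) + 1) (by omega) t ht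
      have hflux := leakPocket_flux_le hs hc hO hD h3w hIn hε.le hν.le hρ0 hκ0 hρ hκ hX0 hXneg hXc hXd hXpos m t ht
      have hcast1 : (((m + 1 : ℕ) : ℝ)) = ((((m : ℤ) + 1 : ℤ) : ℝ)) := by push_cast; ring
      have hcast2 : (((m + 1 : ℕ) : ℤ)) = (m : ℤ) + 1 := by push_cast; ring
      rw [hcast1, hcast2]
      have heq : E₀ * ((1 + r)⁻¹) ^ m = E₀ * (1 + r) * ((1 + r)⁻¹) ^ (m + 1) := by
        rw [pow_succ, show E₀ * (1 + r) * (((1 + r)⁻¹) ^ m * (1 + r)⁻¹) =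
          E₀ * ((1 + r)⁻¹) ^ m * ((1 + r) * (1 + r)⁻¹) by ring, hq1, mul_one]
      have hcast3 : ((5 : ℝ) * ((((m : ℤ) + 1 : ℤ) : ℝ)) / 2) = (5 : ℝ) * ((((m : ℤ) + 1 : ℤ)) : ℝ) / 2 := rfl
      calc _ ≤ _ := hout
        _ ≤ E₀ * ((1 + r)⁻¹) ^ m := hflux
        _ = _ := heq
  have hshell : ∑ j : Fin 4, (1 / 2 : ℝ) * X j (k : ℤ) t ^ 2 ≤ E₀ * (1 + r) ^ 2 * ((1 + r)⁻¹) ^ k := by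
    cases k with
    | zero =>
      have h := kpProper_lowEnergy_le hs hc hO hD hb0 hν.le hX0 hXneg hXc hXd hXpos 0 t ht
      rw [Finset.range_one, Finset.sum_singleton] at h
      have h1 : E₀ ≤ E₀ * (1 + r) ^ 2 * ((1 + r)⁻¹) ^ 0 := by
        rw [pow_zero, mul_one]
        nlinarith [one_le_pow₀ (n := 2) h1r]
      exact h.trans h1
    | succ m =>
      have hband := kpProper_bandEnergy_le_gateFlux hs hc hO hD hb0 hν.le hX0 hXneg hXc hXd hXpos
        (m := m) (N := m + 1) (by omega) t ht
      rw [Finset.Icc_self, Finset.sum_singleton] at hband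
      have heq : E₀ * (1 + r) * ((1 + r)⁻¹) ^ m = E₀ * (1 + r) ^ 2 * ((1 + r)⁻¹) ^ (m + 1) := by
        rw [pow_succ ((1 + r)⁻¹) m, show E₀ * (1 + r) ^ 2 * (((1 + r)⁻¹) ^ m * (1 + r)⁻¹) =
          E₀ * (1 + r) * ((1 + r)⁻¹) ^ m * ((1 + r) * (1 + r)⁻¹) by ring, hq1, mul_one]
      calc ∑ j : Fin 4, (1 / 2 : ℝ) * X j ((m + 1 : ℕ) : ℤ) t ^ 2 ≤ _ := hband
        _ ≤ E₀ * (1 + r) * ((1 + r)⁻¹) ^ m := hgate m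
        _ = _ := heq
  have hsingle : (1 / 2 : ℝ) * X i (k : ℤ) t ^ 2 ≤ ∑ j : Fin 4, (1 / 2 : ℝ) * X j (k : ℤ) t ^ 2 :=
    Finset.single_le_sum (f := fun j => (1 / 2 : ℝ) * X j (k : ℤ) t ^ 2) (fun j _ => by positivity)
      (Finset.mem_univ i)
  have hweight : (1 + ε₀) ^ (2 * θ * (k : ℝ)) = (1 + r) ^ k := by
    rw [Real.rpow_mul hb0.le, hpow, Real.rpow_natCast]
  rw [hweight]
  calc (1 + r) ^ k * ((1 / 2 : ℝ) * X i (k : ℤ) t ^ 2) ≤ (1 + r) ^ k * (E₀ * (1 + r) ^ 2 * ((1 + r)⁻¹) ^ k) :=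
        mul_le_mul_of_nonneg_left (hsingle.trans hshell) (pow_nonneg hr0.le k)
    _ = (1 + r) ^ 2 * E₀ := by
        rw [show (1 + r) ^ k * (E₀ * (1 + r) ^ 2 * ((1 + r)⁻¹) ^ k) =
          (1 + r) ^ 2 * E₀ * ((1 + r) * (1 + r)⁻¹) ^ k by rw [mul_pow]; ring, hq1, one_pow, mul_one]

/-- **Tail ceiling** for the leak-pocket class (`CeilingAt R ε₀ α`). MODEL lattice statement. [cite: Tao2016AveragedNS, §4 (4.13)] -/
theorem leakPocket_ceilingAt {α : Fin 4 → Fin 4 → Fin 4 → ℤ × ℤ × ℤ → ℝ} {ε₀ ρ κ : ℝ}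
    (hε : 0 < ε₀) (hρ0 : 0 ≤ ρ) (hκ0 : 0 ≤ κ) (hgap : ε₀ < ρ * κ)
    (hρ : ∀ a e : Fin 4, e ≠ 3 → ρ * α a a e (0, 0, 1) ≤ α a a 3 (0, 0, 1))
    (hκ : ∀ a : Fin 4, κ * (α a a 0 (0, 0, 1) + α a a 1 (0, 0, 1) + α a a 2 (0, 0, 1)) ≤ α a a 3 (0, 0, 1))
    (hD : ∀ a b i : Fin 4, a ≠ b → α a b i (0, 0, 1) = 0)
    (h3w : ∀ e : Fin 4, α 3 3 e (0, 0, 1) = 0) (hIn : ∀ a b i : Fin 4, α a b i (0, 0, 0) = 0) (R : ℝ) :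
    CeilingAt R ε₀ α :=
  subOnsagerCeiling_ceilingAt_of_shellBarrierAt hε (leakPocket_shellBarrierAt hε hρ0 hκ0 hgap hρ hκ hD h3w hIn R)

/-- **The registered stubs' currency**: the body of the skeleton's `PrimaryGradedAt R ε₀ α` (verbatim) for every leak-pocket network with
`ρκ > ε₀`, at every scale ratio. MODEL lattice statement; a corner of BOTH registered stubs, not the stubs. [cite: Tao2016AveragedNS, §4 (4.13)] -/
theorem leakPocket_primaryGraded {α : Fin 4 → Fin 4 → Fin 4 → ℤ × ℤ × ℤ → ℝ} {ε₀ ρ κ : ℝ}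
    (hε : 0 < ε₀) (hρ0 : 0 ≤ ρ) (hκ0 : 0 ≤ κ) (hgap : ε₀ < ρ * κ)
    (hρ : ∀ a e : Fin 4, e ≠ 3 → ρ * α a a e (0, 0, 1) ≤ α a a 3 (0, 0, 1))
    (hκ : ∀ a : Fin 4, κ * (α a a 0 (0, 0, 1) + α a a 1 (0, 0, 1) + α a a 2 (0, 0, 1)) ≤ α a a 3 (0, 0, 1))
    (hD : ∀ a b i : Fin 4, a ≠ b → α a b i (0, 0, 1) = 0)
    (h3w : ∀ e : Fin 4, α 3 3 e (0, 0, 1) = 0) (hIn : ∀ a b i : Fin 4, α a b i (0, 0, 0) = 0) (R : ℝ) :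
    Literature.Analysis.FluidPDE.TaoCascade.InTableClass R α →
      (∀ (Y : Fin 4 → ℤ → ℝ → ℝ) (τ : ℝ), (∀ (j : Fin 4) (k : ℤ), 1 ≤ k → 0 ≤ Y j k τ) → ∀ δ : ℝ, 0 < δ →
        ∀ (i : Fin 4) (n : ℤ), 1 ≤ n → Y i n τ = 0 → 0 ≤ Literature.Analysis.FluidPDE.TaoCascade.quadTerm δ α Y i n τ) →
      (∀ a b i : Fin 4, a ≠ b → α a b i (0, 0, 1) = 0) →
      ∃ (lev : Fin 4 → ℕ) (L : ℕ), (∀ a, lev a ≤ L) ∧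
        (∀ a, lev a ≠ 0 → (∃ e, α a a e (0, 0, 1) ≠ 0) →
          (∀ j, α j j a (0, 0, 1) ≠ 0 → lev j < lev a ∧ (lev j = 0 ∨ ∃ e', α j j e' (0, 0, 1) ≠ 0)) ∧
          (∀ i₁ i₂, i₁ ≠ a → i₂ ≠ a → α i₁ i₂ a (0, 0, 0) ≠ 0 →
            (lev i₁ < lev a ∧ (lev i₁ = 0 ∨ ∃ e', α i₁ i₁ e' (0, 0, 1) ≠ 0)) ∧
            (lev i₂ < lev a ∧ (lev i₂ = 0 ∨ ∃ e', α i₂ i₂ e' (0, 0, 1) ≠ 0))) ∧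
          (∃ e, α a a e (0, 0, 1) ≠ 0 ∧
            (∀ j, α e e j (0, 0, 1) ≠ 0 → lev j < lev a ∧ (lev j = 0 ∨ ∃ e', α j j e' (0, 0, 1) ≠ 0)) ∧
            (∀ j, j ≠ e → α e e j (0, 0, 0) ≠ 0 →
              lev j < lev a ∧ (lev j = 0 ∨ ∃ e', α j j e' (0, 0, 1) ≠ 0)))) ∧
        ∃ θ : ℝ, 1 / 2 < θ ∧ θ ≤ 1 ∧ ∃ D : ℝ, 0 ≤ D ∧
          ∀ ν : ℝ, 0 < ν → ∀ (X₀ : Fin 4 → ℝ) (s : ℝ), 0 < s → ∀ X : Fin 4 → ℤ → ℝ → ℝ,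
          (∀ (i : Fin 4) (k : ℤ), X i k 0 = if k = 0 then X₀ i else 0) →
          (∀ (i : Fin 4) (k : ℤ), k < 0 → ∀ t : ℝ, X i k t = 0) →
          (∃ M : ℝ, ∀ (t : ℝ) (i : Fin 4) (k : ℤ), (1 + (1 + ε₀) ^ ((10 : ℝ) * k)) * |X i k t| ≤ M) →
          (∀ (i : Fin 4) (k : ℤ), Continuous (X i k)) →
          (∀ (i : Fin 4) (k : ℤ), ∀ t ∈ Set.Icc (0 : ℝ) s, HasDerivWithinAt (X i k)
            (Literature.Analysis.FluidPDE.TaoCascade.quadTerm ε₀ α X i k t - ν * (1 + ε₀) ^ ((2 : ℝ) * k) * X i k t)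
            (Set.Icc (0 : ℝ) s) t) →
          (∀ t ∈ Set.Icc (0 : ℝ) s, ∀ (i : Fin 4) (k : ℤ), 1 ≤ k → 0 ≤ X i k t) →
          ∀ t ∈ Set.Icc (0 : ℝ) s, ∀ i, lev i = 0 → ∀ k : ℕ,
            (1 + ε₀) ^ (2 * θ * (k : ℝ)) * ((1 / 2 : ℝ) * X i (k : ℤ) t ^ 2) ≤
              D * (∑ j : Fin 4, (1 / 2 : ℝ) * X₀ j ^ 2) :=
  kpPrimaryGraded_of_shellBarrierAt hε (leakPocket_shellBarrierAt hε hρ0 hκ0 hgap hρ hκ hD h3w hIn R)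

end Summit.NavierStokesRegularity.NavierStokesRegularity.Theorems

end
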